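import Literature.Geometry.Symplectic.JHolomorphicLimitEmbeddedProofs
import Literature.Geometry.Symplectic.JHolomorphicIsolatedIntersectionPersists
import Literature.Geometry.Symplectic.JHolomorphicRepresentationFormula
import HarnessLib

/-!
# Discharged fact: `C¹`-limits of embedded `J`-holomorphic curves in an almost complex
# `4`-manifold are embedded (McDuff 1991, Thm. 1.1 with Thm. 1.4 / Cor. 4.4)

`Literature.Geometry.Symplectic.jHolomorphicLimitOfEmbedded_isEmbedded`
(`Geometry/Symplectic/JHolomorphicLimitEmbedded`) was reduced in the tree to two local facts of
McDuff's paper by `jHolomorphicLimitOfEmbedded_isEmbedded_of_persist_of_noCusp`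
(`Geometry/Symplectic/JHolomorphicLimitEmbeddedProofs`, (5.5) of the paper made elementary):
persistence of isolated intersections (`jHolomorphic_isolatedIntersection_persists`, Thm. 1.1 /
§5 (5.1)) and the no-cusp theorem (`jHolomorphic_immersed_of_limitEmbedded_punctured`, Thm. 1.4 /
Cor. 4.4).  Both are theorems of the tree — `jHolomorphic_isolatedIntersection_persists_holds`
(`JHolomorphicIsolatedIntersectionPersists`, from the generalized Weierstraß theorem) and
`jHolomorphic_immersed_of_limitEmbedded_punctured_holds` (`JHolomorphicRepresentationFormula`, from
the representation formula) — so the fact is discharged by the one-line application below.  No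
statement is changed; no definition, no new named fact (D-0026); net Literature debt **−1**.

## References

* D. McDuff, *The local behaviour of holomorphic curves in almost complex 4-manifolds*,
  J. Differential Geom. 34 (1991) 143–164: Thm. 1.1, Thm. 1.4, Cor. 4.4, Lemma 2.7, (5.5).
  [McDuff1991LocalBehaviour]
-/

noncomputable section

namespace Literature.Geometry.Symplectic

/-- **McDuff 1991, Thm. 1.1 with Thm. 1.4: a `C¹`-limit of embedded `J`-holomorphic discs in an
almost complex `4`-manifold, injective and immersed on a collar, is embedded — the named fact
`jHolomorphicLimitOfEmbedded_isEmbedded` holds**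
(`jHolomorphicLimitOfEmbedded_isEmbedded_of_persist_of_noCusp` applied to
`jHolomorphic_isolatedIntersection_persists_holds` and
`jHolomorphic_immersed_of_limitEmbedded_punctured_holds`).
[cite: McDuff1991LocalBehaviour, Thm 1.1, Thm 1.4, Cor. 4.4, (5.5)] -/
theorem jHolomorphicLimitOfEmbedded_isEmbedded_holds : jHolomorphicLimitOfEmbedded_isEmbedded :=
  jHolomorphicLimitOfEmbedded_isEmbedded_of_persist_of_noCusp
    jHolomorphic_isolatedIntersection_persists_holds
    jHolomorphic_immersed_of_limitEmbedded_punctured_holds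

end Literature.Geometry.Symplectic

end
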